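import Summits.QuantumFields.BalabanUV.T4Continuum.Spine.NE7.Targets

/-!
# BalabanUVNodes ∕ node N19 (NE7) with N20∕N21 — `lt_one` IS NEVER THE OBSTRUCTION: summable weights are eventually below one, and finitely many early levels are matched
# WHOLE at any finite radius, so the hybrid binder list holds FROM SOME `K₀` ON with the bad classes emptied and the shells zeroed before `K₀`

Cell `pub-ymgap` (HUMAN RULING D-0062 Track A ∕ D-0149 width seats), WIDTH SEAT `pub-ymgap-dag-n19-w1` (node n19 = NE7, seat 1 of 3), generation g3,
INTENT-7.  Route `Summits/QuantumFields/YangMills/Theses/BalabanUVNodes.lean`, key item K3⁷ `SpineGivenEndpointR13SepCoPH` (stmt-QuantumFields-20544; v5 stub 2 `stub_expansion13H`, conjuncts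
`KeyedRelWeight` ∕ `KeyedShellWeight` ∕ `KeyedCoreEdgeHolderD4`); filed `--kind proof --supports … --as helper`.  COUNT-NEUTRAL.  THEOREMS ONLY (0 `def`, 0 `sorry`).  ADDITIVE — imports the tree's
`Spine/NE7/Targets` (`Core`; through it `T4MatchingAssembly` (`HybridNE7`, `hybridNE7_of_relWeightBound`), `T4WeightBudget` (`RelWeightBound`, `relWeightBound_of_eventually`), `T4IndicatorShell`
(`ShellWeightBound`)) ONLY; modifies nothing.

WHY.  `T4MatchingAssembly.HybridNE7` carries the field `lt_one : ∀ K, W K + Wsh K < 1` and `RelWeightBound` the field `lt_one : ∀ K, W K < 1` — for EVERY `K`, including the first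
few, where a produced weight bound (King's `e^{−(K+1)}`-type majorants aside) need not be small: the N20 lanes' «policy wall» (dag-n20-w1 `…N20KeyedRelWeightPolicyWall`), the
`hW1 : ∀ K, Σ_{n ∈ Ioc (n⋆ K) K} a n < 1` hypothesis of this seat's `…N19AgeCutRoad` §2–§5.  This file records once and for all that the wall is immaterial for the ∃δ-currency
the crux consumes: the tree's `T4WeightBudget.relWeightBound_of_eventually` already empties the bad classes below a level `K₀`; here the whole binder list is re-assembled from
`K₀ := ` the first level after which the SUMMABLE weights `W + Wsh` stay below `1` (they tend to `0`), with the shells ZEROED and the bad classes EMPTIED before `K₀`, where the two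
runs are matched WHOLE at any finite radius `vol·R_K` (positivity-only matching of all terms — finitely many levels cost nothing in `Σ δ`).  So a producer owes: the two weight
inequalities with `W, Wsh ≥ 0` SUMMABLE (no `< 1`), the shell letters, `Core` on the good cores with summable `δ`, and SOME finite all-terms radius per level.
* §1 [folklore] `exists_forall_ge_lt_of_summable` (summable non-negative-or-not `f`: `∃ K₀, ∀ K ≥ K₀, f K < ε`) · `shellWeightBound_eventually` (zero the shells below `K₀`: still a
  `ShellWeightBound`, weights `𝟙_{K ≥ K₀}·Wsh`) · `summable_piecewise` (`K ↦ if K₀ ≤ K then δ K else R K` is summable iff … — only `Summable δ` is needed).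
* §2 [folklore] ★★ `hybridNE7_eventually` — THE BINDER LIST FROM `K₀` ON, NO `lt_one` HYPOTHESIS: weight inequalities with summable `W ≥ 0`, `ShellWeightBound … Wsh`, `Core` of the cores
  on the good classes with summable `δ`, an all-terms radius `R_K` per level, non-negative terms ⇒ `∃ K₀, HybridNE7 l₀ vol T A B (𝟙_{K≥K₀} Bad) (𝟙_{K≥K₀} W) (𝟙_{K≥K₀} shA) (𝟙_{K≥K₀} shB)
  (𝟙_{K≥K₀} Wsh) (K ↦ if K₀ ≤ K then δ K else R K)` · ★ `hybridNE7_eventually_noShell` (the shell-free instance).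
READING (for the planner ∕ the N20–N21 lanes; located, nothing proposed).  Node U0 consumes `HybridNE7` only through `HybridNE7.matchingModConstants ∕ cauchy` (and their `_tail`
versions), i.e. through `Σ_K hybridDelta < ∞` — a TAIL property; the modified binder list of §2 has the same partition functions (E1∕E2 untouched: shells and bad classes only
re-present `Σ_T A`), so every «`W_K < 1` for all `K`» clause met on a stub-2 road may be replaced by «`W` summable + a finite all-terms radius at the finitely many early levels».

HONEST FRAMING.  Finite-sum ∕ series bookkeeping [folklore] over the tree's SHAPES; every weight inequality, shell letter, `Core`, radius occurs as a HYPOTHESIS; nothing of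
Bałaban's is asserted or instantiated; no estimate of the programme is proved.  NE7 ∕ NE7b ∕ NE7c NOT PRINTED as two-run statements for d = 4 ∕ NOT proved; N19 ∕ N20 ∕ N21 NOT
discharged; K3⁷ OPEN, not claimed; counts UNMOVED (typed 28∕28 · discharged 5∕27, A 5∕28).  Everything below is PROVED (0 `sorry`, 0 named facts, standard axioms); no decl carries a
cite tag.  One finite four-torus programme at fixed ε — NOT ℝ⁴, NOT infinite volume, NOT OS, NOT a mass gap, NOT the Clay problem (R4 closes the conditional finite-𝕋⁴ rung
`BalabanLadder.UV` only).
-/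

noncomputable section

open Finset Filter Topology
open scoped BigOperators

namespace Summit.QuantumFields.YangMills.BalabanUVNodes.N19EventualBinderList

open Summit.QuantumFields.BalabanUV.T4Continuum.Spine.NE7 (Core)
open Literature.MathematicalPhysics.QuantumFieldTheory.Balaban1983to89
open T4WeightBudget (RelWeightBound relWeightBound_of_eventually)
open T4IndicatorShell (ShellWeightBound)
open T4MatchingAssembly (HybridNE7 hybridNE7_of_relWeightBound)

variable {ι : Type*}

/-! ## §1 Eventual smallness of summable weights; zeroing the shells below a level; piecewise rates [folklore] -/

section Tools
variable {l₀ : ℝ} {T : ℕ → Finset ι} {A B shA shB : ℕ → ℝ → ι → ℝ} {Wsh δ R f : ℕ → ℝ} {K₀ : ℕ}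

/-- A summable real sequence is eventually below any positive threshold. [folklore] -/
theorem exists_forall_ge_lt_of_summable (hf : Summable f) {ε : ℝ} (hε : 0 < ε) : ∃ K₀ : ℕ, ∀ K ≥ K₀, f K < ε :=
  Filter.eventually_atTop.mp (hf.tendsto_atTop_zero.eventually (gt_mem_nhds hε))

/-- **ZERO THE SHELLS BELOW `K₀`**: the shell letters persist with shells `𝟙_{K ≥ K₀}·sh` and weights `𝟙_{K ≥ K₀}·Wsh` (non-negative terms needed where the shell becomes `0`). [folklore] -/
theorem shellWeightBound_eventually (h : ShellWeightBound l₀ T A B shA shB Wsh)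
    (hA : ∀ (K : ℕ) (t : ℝ), |t| ≤ l₀ → ∀ τ ∈ T K, 0 ≤ A K t τ) (hB : ∀ (K : ℕ) (t : ℝ), |t| ≤ l₀ → ∀ τ ∈ T K, 0 ≤ B K t τ) :
    ShellWeightBound l₀ T A B (fun K t τ => if K₀ ≤ K then shA K t τ else 0) (fun K t τ => if K₀ ≤ K then shB K t τ else 0)
      (Set.indicator {K | K₀ ≤ K} Wsh) where
  nonneg K := by
    by_cases hK : K₀ ≤ K
    · rw [Set.indicator_of_mem (show K ∈ {K | K₀ ≤ K} from hK)]; exact h.nonneg K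
    · rw [Set.indicator_of_notMem (show K ∉ {K | K₀ ≤ K} from hK)]
  summable := h.summable.indicator _
  sh_nonneg_left K t ht τ hτ := by by_cases hK : K₀ ≤ K <;> simp only [hK, if_true, if_false, le_refl, h.sh_nonneg_left K t ht τ hτ]
  sh_le_left K t ht τ hτ := by by_cases hK : K₀ ≤ K <;> simp only [hK, if_true, if_false, h.sh_le_left K t ht τ hτ, hA K t ht τ hτ]
  sh_nonneg_right K t ht τ hτ := by by_cases hK : K₀ ≤ K <;> simp only [hK, if_true, if_false, le_refl, h.sh_nonneg_right K t ht τ hτ]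
  sh_le_right K t ht τ hτ := by by_cases hK : K₀ ≤ K <;> simp only [hK, if_true, if_false, h.sh_le_right K t ht τ hτ, hB K t ht τ hτ]
  left K t ht := by
    by_cases hK : K₀ ≤ K
    · simp only [hK, if_true]; rw [Set.indicator_of_mem (show K ∈ {K | K₀ ≤ K} from hK)]; exact h.left K t ht
    · simp only [hK, if_false, Finset.sum_const_zero]; rw [Set.indicator_of_notMem (show K ∉ {K | K₀ ≤ K} from hK), zero_mul]
  right K t ht := by
    by_cases hK : K₀ ≤ K
    · simp only [hK, if_true]; rw [Set.indicator_of_mem (show K ∈ {K | K₀ ≤ K} from hK)]; exact h.right K t ht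
    · simp only [hK, if_false, Finset.sum_const_zero]; rw [Set.indicator_of_notMem (show K ∉ {K | K₀ ≤ K} from hK), zero_mul]

/-- A rate that is `δ` from `K₀` on and anything before is summable as soon as `δ` is. [folklore] -/
theorem summable_piecewise (hδ : Summable δ) (K₀ : ℕ) : Summable fun K : ℕ => if K₀ ≤ K then δ K else R K := by
  refine (summable_nat_add_iff K₀).mp (((summable_nat_add_iff K₀).mpr hδ).congr fun n => ?_)
  simp [Nat.le_add_left K₀ n]

end Tools

/-! ## §2 The binder list from `K₀` on, with no `lt_one` hypothesis [folklore] -/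

section Eventually
variable [DecidableEq ι] {l₀ vol : ℝ} {T : ℕ → Finset ι} {A B shA shB : ℕ → ℝ → ι → ℝ} {Bad : ℕ → ℝ → Finset ι} {W Wsh δ R : ℕ → ℝ}

/-- **★★ `HybridNE7` EVENTUALLY — `lt_one` IS NEVER THE OBSTRUCTION** [folklore].  Given: bad classes inside `T`; the two NE7b weight inequalities with `W ≥ 0` SUMMABLE (NO `W < 1`);
NE7c's `ShellWeightBound … Wsh` (summable `Wsh`, termwise letters — NO `W + Wsh < 1`); NE7's `Core` on the good classes' shell-free cores with summable `δ`; for every level SOME finite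
all-terms radius `R_K` (`e^{c ∓ vol·R_K}·A ≤ B ≤ …` on ALL of `T K` — positivity-only matching); non-negative terms.  Then from `K₀ :=` the first level after which `W + Wsh < 1`
(summable ⇒ tends to `0`) the hybrid binder list holds with: bad classes EMPTIED and shells ZEROED before `K₀` (weights the indicators), rate `δ` from `K₀` on and `R` before — and
its `Σ`-budget is unchanged up to finitely many terms.  (`T4WeightBudget.relWeightBound_of_eventually` for the weight; §1 for the shells; the early levels are matched whole.) -/
theorem hybridNE7_eventually (hBad : ∀ (K : ℕ) (t : ℝ), |t| ≤ l₀ → Bad K t ⊆ T K) (hW0 : ∀ K, 0 ≤ W K) (hWs : Summable W)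
    (hbadA : ∀ (K : ℕ) (t : ℝ), |t| ≤ l₀ → ∑ τ ∈ Bad K t, A K t τ ≤ W K * ∑ τ ∈ T K, A K t τ)
    (hbadB : ∀ (K : ℕ) (t : ℝ), |t| ≤ l₀ → ∑ τ ∈ Bad K t, B K t τ ≤ W K * ∑ τ ∈ T K, B K t τ)
    (hSh : ShellWeightBound l₀ T A B shA shB Wsh)
    (hcore : Core l₀ vol T Bad (fun K t τ => A K t τ - shA K t τ) (fun K t τ => B K t τ - shB K t τ) δ) (hδ : Summable δ)
    (hall : ∀ K : ℕ, ∃ c : ℝ, ∀ t : ℝ, |t| ≤ l₀ → ∀ τ ∈ T K, Real.exp (c - vol * R K) * A K t τ ≤ B K t τ ∧ B K t τ ≤ Real.exp (c + vol * R K) * A K t τ) :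
    ∃ K₀ : ℕ, HybridNE7 l₀ vol T A B (fun K t => if K₀ ≤ K then Bad K t else ∅) (Set.indicator {K | K₀ ≤ K} W)
      (fun K t τ => if K₀ ≤ K then shA K t τ else 0) (fun K t τ => if K₀ ≤ K then shB K t τ else 0) (Set.indicator {K | K₀ ≤ K} Wsh)
      (fun K => if K₀ ≤ K then δ K else R K) := by
  have hA : ∀ (K : ℕ) (t : ℝ), |t| ≤ l₀ → ∀ τ ∈ T K, 0 ≤ A K t τ := fun K t ht τ hτ => (hSh.sh_nonneg_left K t ht τ hτ).trans (hSh.sh_le_left K t ht τ hτ)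
  have hB : ∀ (K : ℕ) (t : ℝ), |t| ≤ l₀ → ∀ τ ∈ T K, 0 ≤ B K t τ := fun K t ht τ hτ => (hSh.sh_nonneg_right K t ht τ hτ).trans (hSh.sh_le_right K t ht τ hτ)
  obtain ⟨K₀, hK₀⟩ := exists_forall_ge_lt_of_summable (hWs.add hSh.summable) one_pos
  refine ⟨K₀, hybridNE7_of_relWeightBound
    (relWeightBound_of_eventually (K₀ := K₀) (fun K t ht _ => hBad K t ht) (fun K _ => hW0 K)
      (fun K hK => by have h := hK₀ K hK; have h' := hSh.nonneg K; linarith) hWs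
      (fun K t ht _ => hbadA K t ht) (fun K t ht _ => hbadB K t ht))
    (shellWeightBound_eventually hSh hA hB) (fun K => ?_) (summable_piecewise hδ K₀) (fun K => ?_)⟩
  · -- lt_one: from K₀ on by the choice of K₀, before it `0 + 0 < 1`
    by_cases hK : K₀ ≤ K
    · rw [Set.indicator_of_mem (show K ∈ {K | K₀ ≤ K} from hK), Set.indicator_of_mem (show K ∈ {K | K₀ ≤ K} from hK)]
      exact hK₀ K hK
    · rw [Set.indicator_of_notMem (show K ∉ {K | K₀ ≤ K} from hK), Set.indicator_of_notMem (show K ∉ {K | K₀ ≤ K} from hK), add_zero]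
      exact one_pos
  · -- core: from K₀ on the given `Core`; before it all terms at radius `R K`, shells zero, no bad class
    by_cases hK : K₀ ≤ K
    · obtain ⟨c, hc⟩ := hcore K
      refine ⟨c, fun t ht τ hτ => ?_⟩
      simp only [hK, if_true] at hτ ⊢
      exact hc t ht τ hτ
    · obtain ⟨c, hc⟩ := hall K
      refine ⟨c, fun t ht τ hτ => ?_⟩
      simp only [hK, if_false, Finset.sdiff_empty, sub_zero] at hτ ⊢
      exact hc t ht τ hτ

/-- **★ THE SHELL-FREE INSTANCE** [folklore]: summable `W ≥ 0` with the two weight inequalities (no `W < 1`), `Core` on the good classes with summable `δ`, an all-terms radius per level,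
non-negative terms ⇒ `∃ K₀, HybridNE7 …` with zero shells, bad classes emptied before `K₀`. -/
theorem hybridNE7_eventually_noShell (hBad : ∀ (K : ℕ) (t : ℝ), |t| ≤ l₀ → Bad K t ⊆ T K) (hW0 : ∀ K, 0 ≤ W K) (hWs : Summable W)
    (hbadA : ∀ (K : ℕ) (t : ℝ), |t| ≤ l₀ → ∑ τ ∈ Bad K t, A K t τ ≤ W K * ∑ τ ∈ T K, A K t τ)
    (hbadB : ∀ (K : ℕ) (t : ℝ), |t| ≤ l₀ → ∑ τ ∈ Bad K t, B K t τ ≤ W K * ∑ τ ∈ T K, B K t τ)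
    (hA : ∀ (K : ℕ) (t : ℝ), |t| ≤ l₀ → ∀ τ ∈ T K, 0 ≤ A K t τ) (hB : ∀ (K : ℕ) (t : ℝ), |t| ≤ l₀ → ∀ τ ∈ T K, 0 ≤ B K t τ)
    (hcore : Core l₀ vol T Bad A B δ) (hδ : Summable δ)
    (hall : ∀ K : ℕ, ∃ c : ℝ, ∀ t : ℝ, |t| ≤ l₀ → ∀ τ ∈ T K, Real.exp (c - vol * R K) * A K t τ ≤ B K t τ ∧ B K t τ ≤ Real.exp (c + vol * R K) * A K t τ) :
    ∃ K₀ : ℕ, HybridNE7 l₀ vol T A B (fun K t => if K₀ ≤ K then Bad K t else ∅) (Set.indicator {K | K₀ ≤ K} W)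
      (fun K _ _ => if K₀ ≤ K then (0 : ℝ) else 0) (fun K _ _ => if K₀ ≤ K then (0 : ℝ) else 0) (Set.indicator {K | K₀ ≤ K} fun _ => (0 : ℝ))
      (fun K => if K₀ ≤ K then δ K else R K) :=
  hybridNE7_eventually (shA := fun _ _ _ => 0) (shB := fun _ _ _ => 0) hBad hW0 hWs hbadA hbadB (T4MatchingAssembly.shellWeightBound_zero hA hB)
    (by simpa only [sub_zero] using hcore) hδ hall

end Eventually

end Summit.QuantumFields.YangMills.BalabanUVNodes.N19EventualBinderList

end
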